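import Summits.QuantumFields.YangMills.Theorems.BalabanUVNodesN18AtWalkRecords
import Summits.QuantumFields.BalabanUV.T4Continuum.Spine.NE5.TwoRunTorusNE5All8
import Summits.QuantumFields.BalabanUV.T4Continuum.Spine.NE5.TwoRunTorusNE5Sizes

/-!
# BalabanUVNodes ∕ N18 — `N18At` ON THE CARRIERS OF RECORD FROM WALK RECORDS OVER THE DATA SPACE WITH THE CONSTANTS EXHIBITED:
# the route-P1 ∕ data-direction analogue of the END `TwoRunTorusNE5Final8.ne5_end_final_all8` — Bałaban's constants record `c`
# (any block size `L ≥ 8`), the (2.20)∕(2.22) size constants and ONE walk package for all scales and members exported BEFORE the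
# data; Lemma 3's printed restrictions, the located numerals and the p. 17 numerics DISCHARGED (Track A, DAG node N18 = NE5
# `T4OutputRate.NE5 EA EB W κ θ C₅` :211; cluster K4 «SpineRates»; file 7 of seat pub-ymgap-dag-n18-c)

HONEST FRAMING.  Count-neutral kernel bookkeeping (seat pub-ymgap-dag-n18-c g2; `--supports stmt-QuantumFields-19676`): pure
composition BY NAME of LANDED, parameter-free real-number lemmas of the NE5 cell chain — T52 `TwoRunTorusNE5All8.lemma3_witness_all8`
(ONE constants record per block size serving [II] Lemma 3's restrictions for EVERY bond-cube side, the (2.39)–(2.41) numerals,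
`κ₁ ≥ 1`, (2.18)) and T46 `TwoRunTorusNE5Sizes.scalars_sized` (the scale-free letters `ϑ, c_E, g, γ₂, a₂₀, w₀`, the size constants
`C_R, C_σ` and the packages with `SmallTheta`, `hθR1le`, `hsmallKθ`, `hcE`, `hgE`, `hsmallRe`, `hαc`, `hsmall`, `hPa`, `hvol`),
read at the trivial window `θ := 1` (no pencil here: ONE package for all scales and members, configuration size `α = max 2 s`
for a margin bound `s`) — with file 6 `N18AtWalkRecords.n18At_of_termWalkData_record` (file 4 ∘ file 5: T25 + T28 per term in
the data direction).  What REMAINS a hypothesis is then legible and numerics-free: per (member, scale, admissible base point,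
term) ONE record `𝒦 : TermKernels c⁺ 4 (R.cubesPerDir j) ν (Nf j) (Op × Hist)` of the term's kernels as functions of the step's
data in the displacement from the base point, with `TermWalkData 𝒦 (w j)` for THE EXPORTED package (`R = max 2 s · C_R`,
`R_σ = max R_σ0 C_σ`, letters `K̄_Γ, K̄_E, K̄_C, κ, ε`) — NODE O's statement (v) in the data direction, instance 0∕1, NOT claimed;
entrywise σ-holomorphy (NODE O); SYMMETRY of the precision (NODE A, [II] p. 15); the potentials with (2.20) (`w₂₀ ≤ w₀|Z|`) and
the characteristic functions with (2.22) at the exported `γ₂, r_P`; fibre ∕ size bounds `m, n_Λ, n_N`; the identification of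
the step's term functions with the records' (2.14)-display; (2.13) as the definition of the outputs; margins `< s`; the END's
leaves L01–L03 ∕ L05–L09unit AT THE RATE `c.κ`, [KP86]'s reach L10 and the sharp clause.  NE5 NOT IN PRINT ([Balaban1987RG1]
Thm 1 p. 259) and NOT PROVED; NOT a node discharge; one finite four-torus programme at fixed ε; nothing continuum ∕ ℝ⁴ ∕ OS ∕
mass-gap ∕ Clay.  0 `def`, 0 `sorry`.

Sources: T. Bałaban, CMP **109** (1987) [Balaban1987RG1] p. 251 (`L`), (0.24)–(0.25) p. 257, Thm 1 p. 259; CMP **116** (1988)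
[Balaban1988RG2Cluster] (1.5) p. 3, p. 5, p. 13, p. 15, (2.13) p. 14, (2.14)–(2.18) pp. 15–16, (2.20)–(2.26) pp. 16–17, Lemma 3
(2.38) p. 20, (2.39)–(2.41) p. 21; CMP **99** (1985) [Balaban1985BackgroundPropagators] Thm 3.10 p. 416; C. King, CMP **102**
(1986) [King1986] p. 665.  Nothing here is a claim about the Yang–Mills mass gap.
-/

noncomputable section

namespace Summit.QuantumFields.YangMills.BalabanUVNodes.N18AtWalkRecordsSized

open Matrix Set Metric Finset
open Literature.MathematicalPhysics.QuantumFieldTheory.Balaban1983to89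
open Literature.MathematicalPhysics.QuantumFieldTheory.Balaban1983to89.T4OutputRate
open Literature.MathematicalPhysics.QuantumFieldTheory.Balaban1983to89.T4InputCauchyRateData
open Literature.MathematicalPhysics.QuantumFieldTheory.Balaban1983to89.TreeLengthTorus (TPt TDom tsys torusTreeLen)
open Literature.MathematicalPhysics.QuantumFieldTheory.Balaban1983to89.TreeLengthTorusGeometry (TTouch)
open Literature.MathematicalPhysics.QuantumFieldTheory.Balaban1983to89.TreeLengthTorusTransfer (tclosure)
open Literature.MathematicalPhysics.QuantumFieldTheory.Balaban1983to89.B13Lemma3TorusData (TBond)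
open Literature.MathematicalPhysics.QuantumFieldTheory.Balaban1983to89.B13Lemma3TorusTerms (terms weight Z0)
open Literature.MathematicalPhysics.QuantumFieldTheory.Balaban1983to89.B13Term214 (core214 F214 term214)
open Literature.MathematicalPhysics.QuantumFieldTheory.Balaban1983to89.B13Bound143 (invTau)
open Literature.MathematicalPhysics.QuantumFieldTheory.Balaban1983to89.B5TorusCover (UT)
open Literature.MathematicalPhysics.QuantumFieldTheory.Balaban1983to89.B12TreeDecay (K₀)
open Literature.MathematicalPhysics.QuantumFieldTheory.Balaban1983to89.B13Resummation (locE)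
open Literature.MathematicalPhysics.QuantumFieldTheory.Balaban1983to89.B13TermWalkData
  (WalkConsts TermKernels TermWalkData)
open Summit.QuantumFields.BalabanUV.T4Continuum.B13Carriers (TwoRuns)
open Summit.QuantumFields.BalabanUV.T4Continuum.Spine.NE5
open Summit.QuantumFields.BalabanUV.T4Continuum.Spine.NE5.TwoRunTorusNE5All8 (lemma3_witness_all8)
open Summit.QuantumFields.BalabanUV.T4Continuum.Spine.NE5.TwoRunTorusNE5Sizes (scalars_sized)
open Summit.QuantumFields.YangMills.BalabanUVNodes.N18AtWalkRecords (n18At_of_termWalkData_record)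
open YMDAG.UVSplit (N18At)

/-- **`N18At` ON THE CARRIERS OF RECORD FROM PER-MEMBER, PER-BASE-POINT WALK RECORDS OVER THE DATA SPACE — THE PRODUCER's ORDER,
THE CONSTANTS EXHIBITED.**  For EVERY block size `L ≥ 8` there is ONE constants record `c` with `c.L = L` (`1 ≤ c.κ₁`, `0 < c.ε₁`,
(2.18)) such that for all fine-cover data `Nf`, walk letters `K̄_Γ, K̄_E, K̄_C ≥ 0`, `ε, κ > 0`, fibre number `m` and sizes
`n_Λ, n_N ≥ 0` there are constants `C_R > 2`, `C_σ` and `γ₂ > 0, a₂₀ ≥ 0, w₀ > 0` such that for every margin bound `s > 0`, floor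
`R_σ0` and bond-cube side `M ≥ 1` there are packages `w j` (ALL EQUAL in content: letters the given ones, `R = max 2 s · C_R`,
`R_σ = max R_σ0 C_σ`), sizes `α j = max 2 s` and `r_P` such that: for every gauge group, two-run datum `R`, data spaces, member
step models `Mf b` with margins `< s`, τ-regions, contour radius, enumerations, PER-MEMBER ∕ scale ∕ base point ∕ term walk records
`𝒦 b j p Z t` over `Op × Hist` with `TermWalkData (𝒦 b j p Z t) (w j)` at admissible base points, σ-holomorphy, SYMMETRY, potentials
with (2.20) (`w₂₀ ≤ w₀|Z|`), `χ` with (2.22) at `γ₂, r_P`, fibre ∕ size bounds, the identification `hT` of the members' term functions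
with the records' (2.14)-display in the displacement, (2.13) as the DEFINITION of the members' outputs, the leaves L01–L03 ∕
L05–L09unit at the rate `c.κ`, [KP86]'s reach L10 and the sharp clause — `N18At ⟨R.carriers, W, γ, c.κ, EA, EB, θ′, C₅(C₃ε₁), Λ,
C₉, ωm, cr, ρ⟩` BY NAME (file 6 `n18At_of_termWalkData_record`, every numerics binder of it discharged by T52 + T46 at `θ := 1`).
[cite: Balaban1987RG1, p.251, (0.24)–(0.25) p.257, Thm 1 p.259; Balaban1988RG2Cluster, (1.5) p.3, p.5, p.13, p.15, (2.13)–(2.26) pp.14–17, (2.18) p.16, (2.38) p.20, (2.41) p.21; Balaban1985BackgroundPropagators, Thm 3.10 p.416; King1986, p.665] -/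
theorem n18At_of_termWalkData_sized :
    ∀ (L : ℕ) [NeZero L], 8 ≤ L →
      ∃ c : B13.Consts, c.L = L ∧ 1 ≤ c.κ₁ ∧ 0 < c.ε₁ ∧ (∀ d : ℝ, 0 ≤ d → 0 < invTau c d ∧ invTau c d ≤ 1 / 2) ∧
      ∀ {ν : ℕ} {Nf : ℕ → Fin ν → ℕ} [∀ j i, NeZero (Nf j i)],
      ∀ {KΓ KE KC ε kap : ℝ}, 0 ≤ KΓ → 0 ≤ KE → 0 ≤ KC → 0 < ε → 0 < kap → ∀ (m : ℕ) {nΛ nN : ℝ}, 0 ≤ nΛ → 0 ≤ nN →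
      ∃ (CR Cσ γ₂ a₂₀ w₀ : ℝ), 2 < CR ∧ 0 < γ₂ ∧ 0 ≤ a₂₀ ∧ 0 < w₀ ∧
      ∀ {s : ℝ}, 0 < s → ∀ (Rσ₀ : ℝ) (Mb : ℕ) [NeZero Mb],
      ∃ (w : ℕ → WalkConsts) (α : ℕ → ℝ) (rP : ℝ),
      (∀ j, (w j).Admissible (α j) Rσ₀) ∧ (∀ j, α j = max 2 s) ∧
      (∀ j, (w j).KbarΓ = KΓ ∧ (w j).KbarE = KE ∧ (w j).KbarC = KC ∧ (w j).kap = kap ∧ (w j).ε = ε) ∧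
      (∀ j, (w j).R = max 2 s * CR) ∧ (∀ j, (w j).Rσ = max Rσ₀ Cσ) ∧
      ∀ (G : Type) [GaugeGroup G] (R : TwoRuns G) [∀ j, DecidableEq (TDom 4 (R.cubesPerDir j))]
        [∀ j, DecidableRel (TTouch (d := 4) (N := R.cubesPerDir j))]
        (Op Hist : Type) [NormedAddCommGroup Op] [NormedSpace ℂ Op] [NormedAddCommGroup Hist] [NormedSpace ℂ Hist]
        (Mf : ℝ → StepModel R.carriers Op Hist) {W : Set (ℕ → ℝ)} {γ : ℝ} {EA : Functional R.carriers R.carriers.BgA}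
        {EB : ℝ → Functional R.carriers R.carriers.BgB} {EA₀ E₀ E₁ δ δ' θ θ' cH ω ρ₀ B : ℝ} {k₀ : ℕ}
        -- the (2.18) τ-regions, the contour radius, the enumerations, per scale
        {Uτ : (j : ℕ) → TDom 4 (L * R.cubesPerDir j) → Set ℂ}, (∀ j Y, IsOpen (Uτ j Y)) →
        (∀ j, ∀ Y : TDom 4 (L * R.cubesPerDir j),
          closedBall (0 : ℂ) ((invTau c ((tsys 4 (L * R.cubesPerDir j)).dj Y))⁻¹) ⊆ Uτ j Y) →
        ∀ {r : ℝ}, 0 < r → r ≤ Real.exp c.κ₁ - 1 → (∀ j Y, ∀ ζ ∈ Set.uIcc (0 : ℝ) 1, closedBall (ζ : ℂ) r ⊆ Uτ j Y) →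
        ∀ (lZ : (j : ℕ) → TDom 4 (R.cubesPerDir j) →
            Finset (TDom 4 (L * R.cubesPerDir j)) × Finset (TBond 4 Mb (L * R.cubesPerDir j)) → List (TPt 4 (R.cubesPerDir j))),
        (∀ j Z t, (lZ j Z t).Nodup ∧ (lZ j Z t).toFinset = Z.1 \ tclosure L (R.cubesPerDir j) (Z0 Mb t)) →
        ∀ (lD : (j : ℕ) → Finset (TDom 4 (L * R.cubesPerDir j)) × Finset (TBond 4 Mb (L * R.cubesPerDir j)) →
            List (TDom 4 (L * R.cubesPerDir j))),
        (∀ j t, (lD j t).Nodup ∧ (lD j t).toFinset = t.1) →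
        -- PER MEMBER, PER SCALE, PER BASE POINT, PER TERM: THE WALK RECORDS AT `c⁺` OVER THE DATA SPACE, FOR THE EXPORTED PACKAGE
        ∀ (𝒦 : (b : ℝ) → (j : ℕ) → Op × Hist → (Z : TDom 4 (R.cubesPerDir j)) →
            Finset (TDom 4 (L * R.cubesPerDir j)) × Finset (TBond 4 Mb (L * R.cubesPerDir j)) →
            TermKernels ({ c with κ₁ := c.κ₁ + 1 } : B13.Consts) 4 (R.cubesPerDir j) ν (Nf j) (Op × Hist))
          [∀ b j p Z t, Fintype (𝒦 b j p Z t).C₀] [∀ b j p Z t, DecidableEq (𝒦 b j p Z t).C₀],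
        (∀ b : ℝ, 0 < b → b ≤ γ → ∀ j, ∀ g ∈ W, ∀ (U : R.carriers.BgB) (p : Op × Hist), p ∈ (Mf b).Base j g U →
          ∀ Z, ∀ t ∈ terms L Mb Z, TermWalkData (𝒦 b j p Z t) (w j)) →
        ∀ (Γ : (b : ℝ) → (j : ℕ) → (p : Op × Hist) → (Z : TDom 4 (R.cubesPerDir j)) →
            (t : Finset (TDom 4 (L * R.cubesPerDir j)) × Finset (TBond 4 Mb (L * R.cubesPerDir j))) → Op × Hist →
            (TPt 4 (R.cubesPerDir j) → ℂ) → ((𝒦 b j p Z t).Λ ⊕ (𝒦 b j p Z t).C₀ → ℝ) → ((𝒦 b j p Z t).Λ → ℂ)),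
        (∀ b : ℝ, 0 < b → b ≤ γ → ∀ j, ∀ g ∈ W, ∀ (U : R.carriers.BgB) (p : Op × Hist), p ∈ (Mf b).Base j g U →
          ∀ Z, ∀ t ∈ terms L Mb Z, ∀ u ∈ ball (0 : Op × Hist) (α j), ∀ σ : TPt 4 (R.cubesPerDir j) → ℂ,
          (∀ i, σ i ∈ ball (0 : ℂ) (Real.exp (c.κ₁ + 1))) →
            ∀ X : (𝒦 b j p Z t).Λ ⊕ (𝒦 b j p Z t).C₀ → ℝ,
              Γ b j p Z t u σ X = (𝒦 b j p Z t).G2 σ u *ᵥ fun i => (X i : ℂ)) →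
        ∀ (χY₀ χcP : (b : ℝ) → (j : ℕ) → (p : Op × Hist) → (Z : TDom 4 (R.cubesPerDir j)) →
            (t : Finset (TDom 4 (L * R.cubesPerDir j)) × Finset (TBond 4 Mb (L * R.cubesPerDir j))) →
            ((𝒦 b j p Z t).Λ → ℝ) → ℝ),
        (∀ b : ℝ, 0 < b → b ≤ γ → ∀ j, ∀ g ∈ W, ∀ (U : R.carriers.BgB) (p : Op × Hist), p ∈ (Mf b).Base j g U →
          ∀ Z, ∀ t ∈ terms L Mb Z, ∀ Bf, 0 ≤ χY₀ b j p Z t Bf) →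
        (∀ b : ℝ, 0 < b → b ≤ γ → ∀ j, ∀ g ∈ W, ∀ (U : R.carriers.BgB) (p : Op × Hist), p ∈ (Mf b).Base j g U →
          ∀ Z, ∀ t ∈ terms L Mb Z, ∀ Bf, 0 ≤ χcP b j p Z t Bf) →
        ∀ (Dfam : (b : ℝ) → (j : ℕ) → Op × Hist → TDom 4 (R.cubesPerDir j) →
            Finset (TDom 4 (L * R.cubesPerDir j)) × Finset (TBond 4 Mb (L * R.cubesPerDir j)) →
            Finset (TDom 4 (L * R.cubesPerDir j)))
          (Vk : (b : ℝ) → (j : ℕ) → (p : Op × Hist) → (Z : TDom 4 (R.cubesPerDir j)) →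
            (t : Finset (TDom 4 (L * R.cubesPerDir j)) × Finset (TBond 4 Mb (L * R.cubesPerDir j))) → Op × Hist →
            TDom 4 (L * R.cubesPerDir j) → ((𝒦 b j p Z t).Λ → ℝ) → ℂ),
        -- non-walk data at admissible base points: σ-holomorphy (NODE O), symmetry (NODE A), potentials, measurability
        (∀ b : ℝ, 0 < b → b ≤ γ → ∀ j, ∀ g ∈ W, ∀ (U : R.carriers.BgB) (p : Op × Hist), p ∈ (Mf b).Base j g U →
          ∀ Z, ∀ t ∈ terms L Mb Z, ∀ u ∈ ball (0 : Op × Hist) (α j), ∀ i i',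
          DifferentiableOn ℂ (fun σ => (𝒦 b j p Z t).A2 σ u i i') {σ | ∀ i, σ i ∈ ball (0 : ℂ) (Real.exp (c.κ₁ + 1))}) →
        (∀ b : ℝ, 0 < b → b ≤ γ → ∀ j, ∀ g ∈ W, ∀ (U : R.carriers.BgB) (p : Op × Hist), p ∈ (Mf b).Base j g U →
          ∀ Z, ∀ t ∈ terms L Mb Z, ∀ u ∈ ball (0 : Op × Hist) (α j), ∀ i i',
          DifferentiableOn ℂ (fun σ => (𝒦 b j p Z t).G2 σ u i i') {σ | ∀ i, σ i ∈ ball (0 : ℂ) (Real.exp (c.κ₁ + 1))}) →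
        (∀ b : ℝ, 0 < b → b ≤ γ → ∀ j, ∀ g ∈ W, ∀ (U : R.carriers.BgB) (p : Op × Hist), p ∈ (Mf b).Base j g U →
          ∀ Z, ∀ t ∈ terms L Mb Z, ∀ Y Bf, DifferentiableOn ℂ (fun u => Vk b j p Z t u Y Bf) (ball (0 : Op × Hist) (α j))) →
        (∀ b : ℝ, 0 < b → b ≤ γ → ∀ j, ∀ g ∈ W, ∀ (U : R.carriers.BgB) (p : Op × Hist), p ∈ (Mf b).Base j g U →
          ∀ Z, ∀ t ∈ terms L Mb Z, Measurable (χY₀ b j p Z t)) →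
        (∀ b : ℝ, 0 < b → b ≤ γ → ∀ j, ∀ g ∈ W, ∀ (U : R.carriers.BgB) (p : Op × Hist), p ∈ (Mf b).Base j g U →
          ∀ Z, ∀ t ∈ terms L Mb Z, Measurable (χcP b j p Z t)) →
        (∀ b : ℝ, 0 < b → b ≤ γ → ∀ j, ∀ g ∈ W, ∀ (U : R.carriers.BgB) (p : Op × Hist), p ∈ (Mf b).Base j g U →
          ∀ Z, ∀ t ∈ terms L Mb Z, ∀ u ∈ ball (0 : Op × Hist) (α j), ∀ Y, Measurable (Vk b j p Z t u Y)) →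
        (∀ b : ℝ, 0 < b → b ≤ γ → ∀ j, ∀ g ∈ W, ∀ (U : R.carriers.BgB) (p : Op × Hist), p ∈ (Mf b).Base j g U →
          ∀ Z, ∀ t ∈ terms L Mb Z, ∀ u : Op × Hist, ‖u‖ ≤ α j → ∀ σ : TPt 4 (R.cubesPerDir j) → ℂ,
          (∀ i, ‖σ i‖ ≤ Real.exp (c.κ₁ + 1)) → ((𝒦 b j p Z t).A2 σ u).IsSymm) →
        -- (2.22) at the exported `γ₂, r_P` and (2.20) with `w₂₀ ≤ w₀|Z|`, uniform along the data space
        ∀ {w₂₀ : ℝ} (qP : (b : ℝ) → (j : ℕ) → (p : Op × Hist) → (Z : TDom 4 (R.cubesPerDir j)) →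
            (t : Finset (TDom 4 (L * R.cubesPerDir j)) × Finset (TBond 4 Mb (L * R.cubesPerDir j))) →
            ((𝒦 b j p Z t).Λ → ℝ) → ℝ),
        (∀ b : ℝ, 0 < b → b ≤ γ → ∀ j, ∀ g ∈ W, ∀ (U : R.carriers.BgB) (p : Op × Hist), p ∈ (Mf b).Base j g U →
          ∀ Z, ∀ t ∈ terms L Mb Z, ∀ Bf, χY₀ b j p Z t Bf * χcP b j p Z t Bf ≤
            Real.exp (-(γ₂ / 2 * rP ^ 2 * (t.2.card : ℕ)) + γ₂ / 2 * qP b j p Z t Bf)) →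
        (∀ b : ℝ, 0 < b → b ≤ γ → ∀ j, ∀ g ∈ W, ∀ (U : R.carriers.BgB) (p : Op × Hist), p ∈ (Mf b).Base j g U →
          ∀ Z, ∀ t ∈ terms L Mb Z, ∀ Bf, qP b j p Z t Bf ≤ Bf ⬝ᵥ Bf) →
        (∀ b : ℝ, 0 < b → b ≤ γ → ∀ j, ∀ g ∈ W, ∀ (U : R.carriers.BgB) (p : Op × Hist), p ∈ (Mf b).Base j g U →
          ∀ Z, ∀ t ∈ terms L Mb Z, ∀ u ∈ ball (0 : Op × Hist) (α j), ∀ τ : TDom 4 (L * R.cubesPerDir j) → ℂ,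
          (∀ Y, τ Y ∈ Uτ j Y) →
            ∀ Bf, ∑ Y ∈ Dfam b j p Z t, ‖τ Y‖ * ‖Vk b j p Z t u Y Bf‖ ≤ a₂₀ / 2 * (Bf ⬝ᵥ Bf) + w₂₀) →
        (∀ j, ∀ Z : TDom 4 (R.cubesPerDir j), w₂₀ ≤ w₀ * ((Z.1).card : ℝ)) →
        -- fibre and size bounds
        (∀ b : ℝ, 0 < b → b ≤ γ → ∀ j, ∀ g ∈ W, ∀ (U : R.carriers.BgB) (p : Op × Hist), p ∈ (Mf b).Base j g U →
          ∀ Z, ∀ t ∈ terms L Mb Z, (𝒦 b j p Z t).m ≤ m) →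
        (∀ b : ℝ, 0 < b → b ≤ γ → ∀ j, ∀ g ∈ W, ∀ (U : R.carriers.BgB) (p : Op × Hist), p ∈ (Mf b).Base j g U →
          ∀ Z, ∀ t ∈ terms L Mb Z, ∀ x : UT (Nf j), (Finset.univ.filter fun i => (𝒦 b j p Z t).locN i = x).card ≤ m) →
        (∀ b : ℝ, 0 < b → b ≤ γ → ∀ j, ∀ g ∈ W, ∀ (U : R.carriers.BgB) (p : Op × Hist), p ∈ (Mf b).Base j g U →
          ∀ Z, ∀ t ∈ terms L Mb Z, (Fintype.card (𝒦 b j p Z t).Λ : ℝ) ≤ nΛ * ((Z.1).card : ℝ)) →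
        (∀ b : ℝ, 0 < b → b ≤ γ → ∀ j, ∀ g ∈ W, ∀ (U : R.carriers.BgB) (p : Op × Hist), p ∈ (Mf b).Base j g U →
          ∀ Z, ∀ t ∈ terms L Mb Z, (Fintype.card ((𝒦 b j p Z t).Λ ⊕ (𝒦 b j p Z t).C₀) : ℝ) ≤ nN * ((Z.1).card : ℝ)) →
        -- the members' term functions ARE the records' (2.14)-display in the displacement; (2.13) defines the outputs
        ∀ (T : ℝ → (j : ℕ) → (Z : TDom 4 (R.cubesPerDir j)) →
            Finset (TDom 4 (L * R.cubesPerDir j)) × Finset (TBond 4 Mb (L * R.cubesPerDir j)) → Op × Hist → ℂ),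
        (∀ b : ℝ, 0 < b → b ≤ γ → ∀ j, ∀ g ∈ W, ∀ (U : R.carriers.BgB) (p : Op × Hist), p ∈ (Mf b).Base j g U →
          ∀ Z, ∀ t ∈ terms L Mb Z, ∀ u ∈ ball (0 : Op × Hist) (α j), T b j Z t (p + u) =
            term214 r (lZ j Z t) (lD j t) (core214 (fun σ => (𝒦 b j p Z t).A2 σ u) (Γ b j p Z t u)
              (F214 t.2.card (χY₀ b j p Z t) (χcP b j p Z t) (Dfam b j p Z t) (Vk b j p Z t u))) 0 0) →
        (∀ b : ℝ, 0 < b → b ≤ γ → ∀ (X : R.carriers.Dom) (z : Op × Hist),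
          (Mf b).Out X.1 z.1 z.2 X =
            locE (TTouch (d := 4) (N := R.cubesPerDir X.1)) (fun Z : (tsys 4 (R.cubesPerDir X.1)).Dom => Z.1)
              (fun Z => ∑ t ∈ terms L Mb Z, T b X.1 Z t z) X.2.1) →
        -- the margins of every member are below the exported configuration size
        (∀ b : ℝ, 0 < b → b ≤ γ → ∀ j, (Mf b).rOp j < s ∧ (Mf b).rHist j < s) →
        -- the END's leaves at the rate `c.κ`, [KP86]'s reach, the sharp clause
        (∀ b : ℝ, 0 < b → b ≤ γ → L01 (Mf b) EA W) → (∀ b : ℝ, 0 < b → b ≤ γ → L02 (Mf b) (EB b) W) →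
        (∀ b : ℝ, 0 < b → b ≤ γ → L03 (Mf b) (EB b) W) → L05 EA W EA₀ c.κ →
        (∀ b : ℝ, 0 < b → b ≤ γ → L06 (EB b) W E₀ c.κ) → (∀ b : ℝ, 0 < b → b ≤ γ → L07 (Mf b) W δ θ) →
        (∀ b : ℝ, 0 < b → b ≤ γ → L08 (Mf b) W c.κ E₀ δ' θ) → (∀ b : ℝ, 0 < b → b ≤ γ → L09aff (Mf b) W) →
        (∀ b : ℝ, 0 < b → b ≤ γ → L09blind (Mf b) W) → (∀ b : ℝ, 0 < b → b ≤ γ → L09hom (Mf b) W) →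
        (∀ b : ℝ, 0 < b → b ≤ γ → L09unit (Mf b) W c.κ E₁ cH ω) →
        0 < E₁ → 0 ≤ δ + δ' → 0 ≤ θ → θ ≤ θ' → θ' ≤ 1 → 0 ≤ cH → 0 < ω → ρ₀ < 1 →
        (δ + δ') * θ ^ k₀ + cH * (EA₀ + E₀) / (1 - ω) ≤ ρ₀ → 0 ≤ B → (∀ k < k₀, EA₀ + E₀ ≤ B * θ ^ k) →
        Real.exp 1 * 9 * 64 * K₀ 64 8 ^ 2 * c.C3act * cH * c.ε₁ < (θ' - ω) * (1 - ρ₀) →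
        ∀ (Λ : ℕ → ℕ → ℝ) (C₉ ωm cr ρ : ℝ),
        N18At ⟨R.carriers, W, γ, c.κ, EA, EB, θ',
          (Real.exp 1 * 9 * 64 * K₀ 64 8 ^ 2 * (c.C3act * c.ε₁) / (1 - ρ₀) * (δ + δ') + B) * (θ' - ω) /
            (θ' - (ω + Real.exp 1 * 9 * 64 * K₀ 64 8 ^ 2 * (c.C3act * c.ε₁) / (1 - ρ₀) * cH)), Λ, C₉, ωm, cr, ρ⟩ := by
  obtain ⟨a₂, a₂', a₅, Aabs, Bc, hcL⟩ := lemma3_witness_all8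
  intro L _ hLL
  obtain ⟨c, hLc, hc⟩ := hcL L hLL
  -- the clauses on `c` alone and `0 < a₅`, read at `M = 1`
  obtain ⟨-, hL, -, hε₁, -, -, -, -, -, -, -, -, -, -, -, -, -, -, -, -, -, -, -, -, -, -, -, -, -,
    -, -, -, -, -, -, -, -, -, -, ha₅, hκ₁, hτ⟩ := hc 1 Nat.one_pos
  refine ⟨c, hLc, hκ₁, hε₁, hτ, ?_⟩
  intro ν Nf _ KΓ KE KC ε kap hKΓ hKE hKC hε hkap m nΛ nN hnΛ hnN
  -- T46 §2: the scale-free letters and the two size constants, from the O(1) letters and `a₅` alone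
  have hκa : 4 * kap / 5 < kap := by linarith
  have hκb : 3 * kap / 5 < 4 * kap / 5 := by linarith
  have h2 : 2 * kap / 5 < 3 * kap / 5 := by linarith
  have h1 : kap / 5 < 2 * kap / 5 := by linarith
  have h0 : 0 < kap / 5 := by linarith
  obtain ⟨ϑ, cE, g, γ₂, a₂₀, w₀, CR, Cσ, -, -, -, hγ₂, ha₂₀, hw₀, hCR, hαc, hsmallG, hsz⟩ :=
    scalars_sized hKΓ hKE hKC hε hkap (Nat.cast_nonneg m) ν hκa hκb h2 h1 h0 hnΛ hnN ha₅
  refine ⟨CR, Cσ, γ₂, a₂₀, w₀, hCR, hγ₂, ha₂₀, hw₀, ?_⟩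
  intro s hs Rσ₀ Mb _
  obtain ⟨a, -, -, hε₁', hα₆, hε₀, hδ, hδ7, hκc, ha, hR15, hR16, hR16', hR17, h231,
    ha₂, hκ229, hsm229, habsk, h18half, h18, ha₂', hκ229', hsm229', hR20, ha₅0, habs, hAc, hC3, hAct, hlarge,
    hsmall41, -, -, -, -, -, -, -, -, -, -⟩ := hc Mb (Nat.pos_of_ne_zero (NeZero.ne Mb))
  -- the trivial window `θ := 1`: ONE package for all scales, configuration size `max 2 s`
  obtain ⟨w, α, rP, hw, hα1, -, hsm, hκaw, hlett, hαeq, hReq, hRσeq, hR1, hKθ, hcEj, hgEj, hRe, hPa, hvol⟩ :=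
    hsz 1 s Rσ₀ a ha
  have hαeq' : ∀ j, α j = max 2 s := fun j => by rw [hαeq j, one_pow, div_one]
  have hReq' : ∀ j, (w j).R = max 2 s * CR := fun j => by rw [hReq j, one_pow, div_one]
  have hsα : ∀ j, s ≤ α j := fun j => (hαeq' j).symm ▸ le_max_right 2 s
  have hC3nn : 0 ≤ c.C3act := nonneg_of_mul_nonneg_left (by simpa [mul_comm] using hAct) hε₁'
  refine ⟨w, α, rP, hw, hαeq', hlett, hReq', hRσeq, ?_⟩
  intro G _ R _ _ Op Hist _ _ _ _ Mf W γ EA EB EA₀ E₀ E₁ δ δ' θ θ' cH ω ρ₀ B k₀ Uτ hUτ hUtau r hr hr' hsubτ lZ hlZ lD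
    hlD 𝒦 _ _ h𝒦 Γ hlin χY₀ χcP hχ0 hχc0 Dfam Vk hAhol hGhol hVholb hχm hχcm hVm hAs w₂₀ qP h222 hqP h220U hw₂₀ hm hfibN
    hΛ hN T hT hrep hμ l01 l02 l03 l05 l06 l07 l08 l09aff l09blind l09hom l09unit hE₁ hδδ' hθ hθθ' hθ'1 hcH hω hρ₀
    l10near hB l10first hS Λ C₉ ωm cr ρ
  exact n18At_of_termWalkData_record R c hL hLc hα₆ hε₀ hδ hδ7 hκc ha hR15 hR16 hR16' hR17 h231 ha₂ hκ229 hsm229 habsk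
    h18half h18 ha₂' hκ229' hsm229' hR20 ha₅0 habs hAc hC3 Mf hκ₁
    (fun j Y => (hτ _ ((tsys 4 (L * R.cubesPerDir j)).dj_nonneg Y)).1)
    (fun j Y => (hτ _ ((tsys 4 (L * R.cubesPerDir j)).dj_nonneg Y)).2) hUτ hUtau hr hr' hsubτ lZ hlZ lD hlD 𝒦
    (w := fun _ => w) (α := fun _ => α) (Rσ₀ := fun _ _ => Rσ₀) (fun _ _ _ j => hw j)
    (fun _ _ _ j => one_pos.trans (hα1 j)) h𝒦 Γ hlin χY₀ χcP hχ0 hχc0 Dfam Vk hAhol hGhol hVholb hχm hχcm hVm hAs qP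
    h222 hγ₂.le hqP ha₂₀ h220U hm hfibN (fun _ _ _ j => hκaw j) hκb h2 h1 h0 (fun _ _ _ j => hsm j)
    (fun b hb hbγ j g' hg U p hp Z t ht =>
      hR1 j _ (Nat.cast_nonneg _) (Nat.cast_le.2 (hm b hb hbγ j g' hg U p hp Z t ht)))
    (fun _ _ _ j => hKθ j) (fun _ _ _ j => hcEj j) (fun _ _ _ j => hgEj j) (fun _ _ _ j => hRe j) hαc hsmallG hPa
    (fun b hb hbγ j g' hg U p hp Z t ht => hvol j _ _ _ _ (Nat.cast_nonneg _) (Nat.cast_nonneg _) (Nat.cast_nonneg _)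
      (hΛ b hb hbγ j g' hg U p hp Z t ht) (hN b hb hbγ j g' hg U p hp Z t ht) (hw₂₀ j Z))
    T hT hrep hC3nn hε₁'.le hκc hlarge hsmall41 (fun b hb hbγ j => (hμ b hb hbγ j).1.trans_le (hsα j))
    (fun b hb hbγ j => (hμ b hb hbγ j).2.trans_le (hsα j)) l01 l02 l03 l05 l06 l07 l08 l09aff l09blind l09hom l09unit
    hE₁ hδδ' hθ hθθ' hθ'1 hcH hω hρ₀ l10near hB l10first hS Λ C₉ ωm cr ρ

end Summit.QuantumFields.YangMills.BalabanUVNodes.N18AtWalkRecordsSized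

end
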